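import Literature.FieldTheory.AlgClosed.AutFixedSubfield
import Mathlib.RingTheory.TensorProduct.Free
import Mathlib.Algebra.Algebra.Hom.Rat
import HarnessLib

/-!
# `Aut(ℂ)`-descent for vectors: an element of `ℂ ⊗_ℚ U` fixed by every `τ ⊗ 1` lies in `1 ⊗ U`

Topic `LinearAlgebra/BaseChange`; namespace `Literature.LinearAlgebra.BaseChange`.  THEOREMS ONLY (Mathlib + ★
`FieldTheory.AlgClosed.AutFixedSubfield`; no definition, no named fact, no instance, no `sorry`).  PUBLIC, GENERIC form
(any `ℚ`-vector space `U`, no finiteness) of a lemma the tree so far carried only privately and for number fields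
(`Motives/MumfordTateGroupOfOrientationSerreGroupQuotientGalois` `exists_one_tmul_eq_of_forall_twist_eq`,
`Motives/MumfordTateGroupOfCMFamilySerreGroupQuotientGalois`, `Geometry/Kaehler/…` `exists_ratCast_eq_of_forall_ringEquiv`).
Cell hodgecm-mathlib, d6 line, next-run DEF DH2c (A-p09 (g13) census `CENSUS-DH1-DH2.A-p09g13.md`; dedup 2026-08-29T21:34:31Z
«(G3) = yours»): identifies the `Aut(ℂ/ℚ)`-orbit sum of central idempotents of `ℂ ⊗ heckeImage` with a ℚ-RATIONAL element
(print [Liu2021] App. D p. 133 «through the coefficients»).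

MATHEMATICS ([Milne2017] Prop. 4.31 / Cor. 4.34 «`(V ⊗ k′)^{G} = V^{G} ⊗ k′`», here with the group acting on the SCALARS;
[Lang2002] Ch. VIII §1 for `ℂ^{Aut(ℂ)} = ℚ`): in a `ℚ`-basis `(b_i)` of `U` the coordinates of `(τ ⊗ 1) x` are `τ` of the
coordinates of `x` (`repr_rTensor_aut`); if `x` is fixed they are complex numbers fixed by all of `Aut(ℂ)`, hence RATIONAL
(★ `Complex.mem_subfield_of_forall_ringEquiv` at the prime field; cf. ★ `EllipticCurves.exists_ratCast_eq_of_forall_ringEquiv`), and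
`x = 1 ⊗ Σ q_i b_i`.

CONTENT: `rTensor_aut_tmul`, `repr_rTensor_aut`, `repr_one_tmul`,
**`exists_one_tmul_eq_of_forall_rTensor_aut_eq`**, `one_tmul_injective`, `forall_rTensor_aut_eq_iff`, and the ALGEBRA form
`exists_one_tmul_eq_of_forall_map_aut_eq` for `Algebra.TensorProduct.map τ (AlgHom.id ℚ A)` on `ℂ ⊗_ℚ A`.
HC_CM is proved only modulo the 7 printed citations until rung 0 closes; nothing here moves a book.

## References
* [Milne2017] J. S. Milne, *Algebraic Groups*, CUP (2017), Ch. 4 §i, Prop. 4.31 and Cor. 4.34.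
* [Lang2002] S. Lang, *Algebra*, 3rd ed., GTM 211 (2002), Ch. VIII §1 (automorphisms of `ℂ`; with Ch. V §2).
* [Liu2021] Y. Liu, Camb. J. Math. **9** (2021), App. D (D.3) p. 133 (the consumer).
-/

set_option autoImplicit false

noncomputable section

open scoped TensorProduct
open Cardinal

namespace Literature.LinearAlgebra.BaseChange

variable {U : Type*} [AddCommGroup U] [Module ℚ U]

/-- `(τ ⊗ 1)(c ⊗ u) = τ c ⊗ u` (the semilinear `Aut(ℂ)`-action on the scalars of `ℂ ⊗_ℚ U`). [cite: Milne2017, Prop. 4.31 and Cor. 4.34] -/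
@[simp] theorem rTensor_aut_tmul (τ : ℂ ≃+* ℂ) (c : ℂ) (u : U) :
    (τ.toRingHom.toRatAlgHom.toLinearMap.rTensor U) (c ⊗ₜ[ℚ] u) = τ c ⊗ₜ[ℚ] u :=
  LinearMap.rTensor_tmul _ _ _ _

/-- A complex number fixed by every automorphism of `ℂ` is rational — the fixed field of `Aut(ℂ)` is the prime field
(★ `Complex.mem_subfield_of_forall_ringEquiv` for the countable subfield `ℚ ⊂ ℂ`; public twin with heavier imports:
★ `Literature.NumberTheory.EllipticCurves.exists_ratCast_eq_of_forall_ringEquiv`). [folklore] -/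
private theorem exists_ratCast_eq_of_forall_ringEquiv_aux {z : ℂ} (h : ∀ σ : ℂ ≃+* ℂ, σ z = z) : ∃ q : ℚ, (q : ℂ) = z := by
  have hF : #(Rat.castHom ℂ).fieldRange ≤ ℵ₀ := by
    have h := Cardinal.mk_range_le (f := (Rat.castHom ℂ : ℚ → ℂ))
    rw [Cardinal.mkRat] at h
    exact h
  obtain ⟨q, hq⟩ := RingHom.mem_fieldRange.mp
    (Literature.FieldTheory.AlgClosed.Complex.mem_subfield_of_forall_ringEquiv (Rat.castHom ℂ).fieldRange hF
      fun σ _ => h σ)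
  exact ⟨q, by simpa using hq⟩

section Basis

variable {ι : Type*} (b : Module.Basis ι ℚ U)

/-- **Coordinates of `(τ ⊗ 1) x` are `τ` of the coordinates of `x`** in the complexified rational basis `1 ⊗ b_i`.
[cite: Milne2017, Prop. 4.31 and Cor. 4.34] -/
theorem repr_rTensor_aut (τ : ℂ ≃+* ℂ) (x : ℂ ⊗[ℚ] U) (i : ι) :
    (Algebra.TensorProduct.basis ℂ b).repr ((τ.toRingHom.toRatAlgHom.toLinearMap.rTensor U) x) i =
      τ ((Algebra.TensorProduct.basis ℂ b).repr x i) := by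
  induction x using TensorProduct.induction_on with
  | zero => simp only [map_zero, Finsupp.coe_zero, Pi.zero_apply]
  | tmul c v =>
    have hrepr : ∀ a : ℂ, (Algebra.TensorProduct.basis ℂ b).repr (a ⊗ₜ[ℚ] v) i = a * (b.repr v i : ℂ) := fun a => by
      rw [Algebra.TensorProduct.basis_repr_tmul, Finsupp.smul_apply, Finsupp.mapRange_apply, smul_eq_mul, eq_ratCast]
    rw [rTensor_aut_tmul, hrepr, hrepr, map_mul, map_ratCast]
  | add x y hx hy => simp only [map_add, Finsupp.coe_add, Pi.add_apply, hx, hy]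

/-- Coordinates of `1 ⊗ u` are the (rational) coordinates of `u`. [cite: Milne2017, Prop. 4.31 and Cor. 4.34] -/
theorem repr_one_tmul (u : U) (i : ι) :
    (Algebra.TensorProduct.basis ℂ b).repr ((1 : ℂ) ⊗ₜ[ℚ] u) i = (b.repr u i : ℂ) := by
  rw [Algebra.TensorProduct.basis_repr_tmul, Finsupp.smul_apply, Finsupp.mapRange_apply, one_smul, eq_ratCast]

end Basis

/-- **`Aut(ℂ)`-DESCENT FOR VECTORS**: an element of `ℂ ⊗_ℚ U` (`U` ANY `ℚ`-vector space) fixed by `τ ⊗ 1` for every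
`τ ∈ Aut(ℂ)` is of the form `1 ⊗ u`: its coordinates in a complexified rational basis are fixed by `Aut(ℂ)`, hence rational.
[cite: Milne2017, Prop. 4.31 and Cor. 4.34] [cite: Lang2002, Ch. VIII §1 (with Ch. V §2)] -/
theorem exists_one_tmul_eq_of_forall_rTensor_aut_eq {x : ℂ ⊗[ℚ] U}
    (hx : ∀ τ : ℂ ≃+* ℂ, (τ.toRingHom.toRatAlgHom.toLinearMap.rTensor U) x = x) :
    ∃ u : U, (1 : ℂ) ⊗ₜ[ℚ] u = x := by
  classical
  let b := Module.Free.chooseBasis ℚ U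
  let B := Algebra.TensorProduct.basis ℂ b
  -- every coordinate of `x` is rational
  have hq : ∀ i, ∃ q : ℚ, (q : ℂ) = B.repr x i := fun i =>
    exists_ratCast_eq_of_forall_ringEquiv_aux fun τ => by rw [← repr_rTensor_aut b τ x i, hx τ]
  choose q hq using hq
  -- the rational coordinate vector, as a finsupp supported inside `(B.repr x).support`
  let c : _ →₀ ℚ := Finsupp.onFinset (B.repr x).support q fun i hi =>
    Finsupp.mem_support_iff.2 (by rw [← hq i]; exact_mod_cast hi)
  refine ⟨b.repr.symm c, B.repr.injective (Finsupp.ext fun i => ?_)⟩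
  rw [repr_one_tmul, LinearEquiv.apply_symm_apply, Finsupp.onFinset_apply, hq]

/-- `u ↦ 1 ⊗ u : U → ℂ ⊗_ℚ U` is injective (read a coordinate). [cite: Milne2017, Prop. 4.31 and Cor. 4.34] -/
theorem one_tmul_injective : Function.Injective fun u : U => (1 : ℂ) ⊗ₜ[ℚ] u := by
  classical
  intro u v h
  let b := Module.Free.chooseBasis ℚ U
  refine b.repr.injective (Finsupp.ext fun i => ?_)
  have hi := congrArg (fun x => (Algebra.TensorProduct.basis ℂ b).repr x i) h
  simp only [repr_one_tmul] at hi
  exact_mod_cast hi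

/-- **Fixed by all `τ ⊗ 1` iff of the form `1 ⊗ u`.** [cite: Milne2017, Prop. 4.31 and Cor. 4.34] -/
theorem forall_rTensor_aut_eq_iff (x : ℂ ⊗[ℚ] U) :
    (∀ τ : ℂ ≃+* ℂ, (τ.toRingHom.toRatAlgHom.toLinearMap.rTensor U) x = x) ↔ ∃ u : U, (1 : ℂ) ⊗ₜ[ℚ] u = x := by
  refine ⟨exists_one_tmul_eq_of_forall_rTensor_aut_eq, ?_⟩
  rintro ⟨u, rfl⟩ τ
  rw [rTensor_aut_tmul, map_one]

/-- **Algebra form**: for a `ℚ`-algebra `A`, an element of the `ℂ`-algebra `ℂ ⊗_ℚ A` fixed by every algebra map `τ ⊗ id`,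
`τ ∈ Aut(ℂ)`, is `1 ⊗ a` for a (unique) `a ∈ A` — e.g. an `Aut(ℂ/ℚ)`-stable central idempotent of `ℂ ⊗ A` comes from `A`.
[cite: Milne2017, Prop. 4.31 and Cor. 4.34] [cite: Lang2002, Ch. VIII §1 (with Ch. V §2)] -/
theorem exists_one_tmul_eq_of_forall_map_aut_eq {A : Type*} [Ring A] [Algebra ℚ A] {x : ℂ ⊗[ℚ] A}
    (hx : ∀ τ : ℂ ≃+* ℂ, Algebra.TensorProduct.map τ.toRingHom.toRatAlgHom (AlgHom.id ℚ A) x = x) :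
    ∃ a : A, (1 : ℂ) ⊗ₜ[ℚ] a = x := by
  refine exists_one_tmul_eq_of_forall_rTensor_aut_eq fun τ => ?_
  have key : ∀ y : ℂ ⊗[ℚ] A, (τ.toRingHom.toRatAlgHom.toLinearMap.rTensor A) y =
      Algebra.TensorProduct.map τ.toRingHom.toRatAlgHom (AlgHom.id ℚ A) y := fun y => by
    induction y using TensorProduct.induction_on with
    | zero => rw [map_zero, map_zero]
    | tmul c a => rw [rTensor_aut_tmul, Algebra.TensorProduct.map_tmul]; rfl
    | add y z hy hz => rw [map_add, map_add, hy, hz]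
  rw [key, hx τ]

end Literature.LinearAlgebra.BaseChange
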